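import Mathlib
import Summits.ValiantsHypothesis.ValiantsHypothesis.Theorems.NumTameTameA3RoundingStep
import HarnessLib

/-!
# Route NumTame — crux `TameA3` (stmt-ValiantsHypothesis-5386), stub `stub_rounding` PROVED:
# the error recursion of the clamped complex fixed-point run

Registered stub 1 of the crux line `Cruxes/TameA3/Lines/birth.lean` ("ERROR RECURSION", the
numerical-analysis half of the route's two-layer plan `TameA3 ⇐ FixedPointGates → ErrorRecursion`):
`stub_rounding` below is the registered stub (`Stmt.stub_rounding`) VERBATIM, proved with `c = 3` — for every
fan-in-two circuit `P` over `ℂ`, every Boolean point `x`, every `R` bounding by `2^R` the moduli of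
the operand constants, sum weights, output constant and of ALL exact gate values at `x`, and every
precision `B ≥ (R + |P| + 2)^3`, the clamped fixed-point run in format `(R+2, B)` satisfies
`‖evalFx P (R+2) B x / 2^B − eval (boolPoint x) P.eval‖ < 1/2`. One gate of fan-in `≤ 2` whose
weights, constants and exact value have modulus `≤ 2^R` turns an error `η` into at most `K(η + δ)`,
`δ = 2^{-B}`, `K = 2^{R+2} + 8`, every clamp idle while `K(η + δ) ≤ 1` (`gateFx_error`, from the
operand / sum-term bounds of `NumTameTameA3RoundingStep.lean`); by reverse induction over the gate
list gate `i` is tracked to within `(i+1) K^{i+1} / 2^B` (`gateValuesFx_error`), and `4(s+1)K^{s+1} ≤ 2^B` follows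
from `(R+s+2)^3 ≤ B` (`budget_le_two_pow`: `K ≤ 2^{R+4}`, `s+1 ≤ 2^s`), so the output is within
`(s+1)K^{s+1}/2^B ≤ 1/4 < 1/2`; fan-in two and all four tameness hypotheses are used.

Honest framing: one of two stubs of a crux of a conditional route (NumTame); `VP ≠ VNP` is NOT
proved and nothing here is progress on it.

## References

* P. Bürgisser, *Cook's versus Valiant's hypothesis*, Theoret. Comput. Sci. 235 (2000), §5 (A3).
  [cite: Burgisser2000TCS, §5 (A3)]
* P. Koiran, *A weak version of the Blum–Shub–Smale model*, JCSS 54 (1997); L. Blum, F. Cucker,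
  M. Shub, S. Smale, *Complexity and Real Computation* (1998) (bit-model simulation with rounding).
-/

set_option linter.dupNamespace false

noncomputable section

open MvPolynomial

/-! ## Part 2b — one product/sum gate of the clamped fixed-point run -/

namespace Summit.ValiantsHypothesis.ValiantsHypothesis.Theorems.NumTame

open Literature.Computability.AlgebraicComplexity ArithCircuit FixedPoint

section Step

variable {σ : Type*} (x : σ → Bool) (R B : ℕ) (vals : List (MvPolynomial σ ℂ))
  (fx : List GaussianInt) (η : ℝ)

/-- **One gate of the fixed-point run tracks the exact gate** (fan-in `≤ 2`, weights and constants
of modulus `≤ 2^R`, exact gate value of modulus `≤ 2^R`): the error grows from `η` to at most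
`K (η + 2^{-B})`, `K = 2^{R+2} + 8`, provided `K (η + 2^{-B}) ≤ 1` (which keeps every clamp idle).
[folklore] -/
theorem gateFx_error (hlen : fx.length = vals.length) (hη : 0 ≤ η)
    (hK : ((2 : ℝ) ^ (R + 2) + 8) * (η + 1 / (2 : ℝ) ^ B) ≤ 1)
    (herr : ∀ (i : ℕ) (hi : i < fx.length),
      ‖(fx[i] : ℂ) / (2 : ℂ) ^ B - eval (boolPoint ℂ x) (vals[i]'(hlen ▸ hi))‖ ≤ η)
    (hvals : ∀ v ∈ vals, ‖eval (boolPoint ℂ x) v‖ ≤ (2 : ℝ) ^ R)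
    (g : Gate ℂ σ) (hfan : g.fanIn ≤ 2)
    (hconst : ∀ u ∈ g.args, ∀ a, u = Operand.const a → ‖a‖ ≤ (2 : ℝ) ^ R)
    (hw : ∀ args, g = Gate.sum args → ∀ a ∈ args, ‖a.1‖ ≤ (2 : ℝ) ^ R)
    (hg : ‖eval (boolPoint ℂ x) (g.eval vals)‖ ≤ (2 : ℝ) ^ R) :
    ‖((gateFx (R + 2) B x fx g : GaussianInt) : ℂ) / (2 : ℂ) ^ B - eval (boolPoint ℂ x) (g.eval vals)‖ ≤
      ((2 : ℝ) ^ (R + 2) + 8) * (η + 1 / (2 : ℝ) ^ B) := by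
  set δ : ℝ := 1 / (2 : ℝ) ^ B with hδdef
  set M : ℝ := (2 : ℝ) ^ R with hMdef
  set K : ℝ := (2 : ℝ) ^ (R + 2) + 8 with hKdef
  have hδ : 0 ≤ δ := by positivity
  have hM1 : 1 ≤ M := one_le_pow₀ (by norm_num)
  have hKM : K = 4 * M + 8 := by rw [hKdef, hMdef, pow_add]; ring
  have hηδ : 0 ≤ η + δ := add_nonneg hη hδ
  have hηδ1 : η + δ ≤ 1 := by nlinarith
  -- a value within `K(η+δ)` of an exact value of modulus `≤ 2^R` lies in the format
  have hidle : ∀ (z : GaussianInt) (e : ℂ), ‖e‖ ≤ M → ‖(z : ℂ) / (2 : ℂ) ^ B - e‖ ≤ K * (η + δ) →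
      clamp (R + 2 + B) z = z := by
    intro z e he hz
    apply clamp_eq_self_of_norm_lt
    calc ‖(z : ℂ) / (2 : ℂ) ^ B‖ ≤ ‖(z : ℂ) / (2 : ℂ) ^ B - e‖ + ‖e‖ := norm_le_norm_sub_add _ _
      _ ≤ 1 + M := add_le_add (hz.trans hK) he
      _ < (2 : ℝ) ^ (R + 2) := by rw [pow_add, ← hMdef]; nlinarith
  cases g with
  | sum args =>
    have hw' : ∀ a ∈ args, ‖a.1‖ ≤ (2 : ℝ) ^ R := hw args rfl
    have hc' : ∀ a ∈ args, ∀ c, a.2 = Operand.const c → ‖c‖ ≤ (2 : ℝ) ^ R :=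
      fun a ha c hc => hconst a.2 (by simp only [Gate.args, List.mem_map]; exact ⟨a, ha, rfl⟩) c hc
    have hterm : ∀ a ∈ args,
        ‖((rshift B (clamp (R + 2 + B) (ofComplex B a.1) * operandFx (R + 2) B x fx a.2) :
            GaussianInt) : ℂ) / (2 : ℂ) ^ B - eval (boolPoint ℂ x) (a.1 • a.2.eval vals)‖ ≤
          M * (η + δ) + δ * (M + 3) :=
      fun a ha => sumTerm_error x R B vals fx η hlen hη hηδ1 herr hvals a (hw' a ha) (hc' a ha)
    simp only [Gate.fanIn, Gate.args, List.length_map] at hfan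
    -- the unclamped sum `S` and its error
    have hS : ‖(((args.map fun a => rshift B (clamp (R + 2 + B) (ofComplex B a.1) *
          operandFx (R + 2) B x fx a.2)).sum : GaussianInt) : ℂ) / (2 : ℂ) ^ B -
          eval (boolPoint ℂ x) ((Gate.sum args).eval vals)‖ ≤ K * (η + δ) := by
      simp only [Gate.eval]
      rcases args with _ | ⟨a, _ | ⟨b, _ | ⟨c, rest⟩⟩⟩
      · simp only [List.map_nil, List.sum_nil, map_zero, zero_div, sub_zero, norm_zero]
        positivity
      · simp only [List.map_cons, List.map_nil, List.sum_cons, List.sum_nil, add_zero]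
        refine (hterm a (by simp)).trans ?_
        rw [hKM]; nlinarith
      · simp only [List.map_cons, List.map_nil, List.sum_cons, List.sum_nil, add_zero, map_add,
          add_div]
        calc _ ≤ ‖((rshift B (clamp (R + 2 + B) (ofComplex B a.1) * operandFx (R + 2) B x fx a.2) :
                GaussianInt) : ℂ) / (2 : ℂ) ^ B - eval (boolPoint ℂ x) (a.1 • a.2.eval vals)‖ +
              ‖((rshift B (clamp (R + 2 + B) (ofComplex B b.1) * operandFx (R + 2) B x fx b.2) :
                GaussianInt) : ℂ) / (2 : ℂ) ^ B - eval (boolPoint ℂ x) (b.1 • b.2.eval vals)‖ := by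
              rw [show ∀ p q r s : ℂ, p + q - (r + s) = (p - r) + (q - s) from fun p q r s => by ring]
              exact norm_add_le _ _
          _ ≤ (M * (η + δ) + δ * (M + 3)) + (M * (η + δ) + δ * (M + 3)) :=
              add_le_add (hterm a (by simp)) (hterm b (by simp))
          _ ≤ K * (η + δ) := by rw [hKM]; nlinarith
      · simp at hfan
    -- the clamp is idle
    have hgate : gateFx (R + 2) B x fx (Gate.sum args) =
        (args.map fun a => rshift B (clamp (R + 2 + B) (ofComplex B a.1) *
          operandFx (R + 2) B x fx a.2)).sum := by
      simp only [gateFx]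
      exact hidle _ _ hg hS
    rw [hgate]
    exact hS
  | prod args =>
    have hc' : ∀ u ∈ args, ∀ c, u = Operand.const c → ‖c‖ ≤ (2 : ℝ) ^ R :=
      fun u hu c hc => hconst u (by simpa [Gate.args] using hu) c hc
    simp only [Gate.fanIn, Gate.args] at hfan
    have hinit : clamp (R + 2 + B) ((2 : GaussianInt) ^ B) = 2 ^ B := clamp_two_pow (R + 2) B (by omega)
    rcases args with _ | ⟨u, _ | ⟨v, _ | ⟨c, rest⟩⟩⟩
    · -- empty product: `1`
      simp only [gateFx, List.foldl_nil, Gate.eval, List.map_nil, List.prod_nil, hinit,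
        toComplex_two_pow_div, map_one, sub_self, norm_zero]
      positivity
    · -- one factor
      obtain ⟨hue, hun⟩ := operandFx_error x R B vals fx η hlen hη herr hvals u (hc' u (by simp))
      simp only [gateFx, List.foldl_cons, List.foldl_nil, hinit, rshift_two_pow_mul, Gate.eval,
        List.map_cons, List.map_nil, List.prod_cons, List.prod_nil, mul_one] at hue ⊢
      have h1 : clamp (R + 2 + B) (operandFx (R + 2) B x fx u) = operandFx (R + 2) B x fx u :=
        hidle _ _ hun (hue.trans (by rw [hKM]; nlinarith))
      rw [h1]
      exact hue.trans (by rw [hKM]; nlinarith)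
    · -- two factors
      obtain ⟨hue, hun⟩ := operandFx_error x R B vals fx η hlen hη herr hvals u (hc' u (by simp))
      obtain ⟨hve, hvn⟩ := operandFx_error x R B vals fx η hlen hη herr hvals v (hc' v (by simp))
      simp only [gateFx, List.foldl_cons, List.foldl_nil, hinit, rshift_two_pow_mul, Gate.eval,
        List.map_cons, List.map_nil, List.prod_cons, List.prod_nil, mul_one]
      set U : GaussianInt := operandFx (R + 2) B x fx u
      set V : GaussianInt := operandFx (R + 2) B x fx v
      set u' : ℂ := (U : ℂ) / (2 : ℂ) ^ B
      set v' : ℂ := (V : ℂ) / (2 : ℂ) ^ B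
      set ue : ℂ := eval (boolPoint ℂ x) (u.eval vals)
      set ve : ℂ := eval (boolPoint ℂ x) (v.eval vals)
      have h1 : clamp (R + 2 + B) U = U := hidle _ _ hun (hue.trans (by rw [hKM]; nlinarith))
      rw [h1]
      -- error of the product before the clamp
      have hsh := norm_rshift_sub_le B (U * V)
      rw [toComplex_mul_div] at hsh
      have hprod : ‖u' * v' - ue * ve‖ ≤ (η + δ) * (M + 1) + M * (η + δ) := by
        refine (norm_mul_sub_mul_le' u' v' ue ve).trans ?_
        have hv'n : ‖v'‖ ≤ M + 1 :=
          calc ‖v'‖ ≤ ‖v' - ve‖ + ‖ve‖ := norm_le_norm_sub_add _ _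
            _ ≤ (η + δ) + M := add_le_add hve hvn
            _ ≤ M + 1 := by linarith
        gcongr
      have herrp : ‖((rshift B (U * V) : GaussianInt) : ℂ) / (2 : ℂ) ^ B - ue * ve‖ ≤ K * (η + δ) :=
        calc _ ≤ ‖((rshift B (U * V) : GaussianInt) : ℂ) / (2 : ℂ) ^ B - u' * v'‖ + ‖u' * v' - ue * ve‖ :=
              norm_sub_le_norm_sub_add_norm_sub _ _ _
          _ ≤ 2 / (2 : ℝ) ^ B + ((η + δ) * (M + 1) + M * (η + δ)) := add_le_add hsh hprod
          _ ≤ K * (η + δ) := by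
              rw [hKM, show (2 : ℝ) / 2 ^ B = 2 * δ by rw [hδdef]; ring]; nlinarith
      have hmul : ‖ue * ve‖ ≤ M := by
        -- the exact product is the gate value
        have : eval (boolPoint ℂ x) ((Gate.prod [u, v]).eval vals) = ue * ve := by
          simp [Gate.eval, ue, ve]
        rw [← this]; exact hg
      rw [hidle _ _ hmul herrp, map_mul]
      exact herrp
    · simp at hfan

end Step

end Summit.ValiantsHypothesis.ValiantsHypothesis.Theorems.NumTame


/-! ## Part 3 — the error recursion along the gate list, and `stub_rounding` -/

namespace Summit.ValiantsHypothesis.ValiantsHypothesis.Theorems.NumTame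

open Literature.Computability.AlgebraicComplexity ArithCircuit FixedPoint

section Run

variable {σ : Type*}

/-- Monotonicity of the error budget `(i+1) K^{i+1}`. [folklore] -/
theorem budget_mono {K : ℝ} (hK : 1 ≤ K) {i n : ℕ} (h : i + 1 ≤ n) :
    ((i : ℝ) + 1) * K ^ (i + 1) ≤ (n : ℝ) * K ^ n := by
  have h1 : ((i : ℝ) + 1) ≤ n := by exact_mod_cast h
  have h2 : K ^ (i + 1) ≤ K ^ n := pow_le_pow_right₀ hK h
  exact mul_le_mul h1 h2 (by positivity) (by positivity)

/-- **The error recursion** (`ErrorRecursion` of the route's plan): along a fan-in-two gate list whose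
constants, sum weights and exact values at `x` have modulus `≤ 2^R`, the clamped fixed-point run in
format `(R+2, B)` satisfies `‖fx_i/2^B − g_i(x)‖ ≤ (i+1)·K^{i+1}/2^B`, `K = 2^{R+2} + 8`, as long as
the total budget `(|gs|+1) K^{|gs|+1} / 2^B ≤ 1` (which keeps every clamp idle). [folklore] -/
theorem gateValuesFx_error (x : σ → Bool) (R B : ℕ) (gs : List (Gate ℂ σ))
    (hfan : ∀ g ∈ gs, g.fanIn ≤ 2)
    (hconst : ∀ g ∈ gs, ∀ u ∈ g.args, ∀ a, u = Operand.const a → ‖a‖ ≤ (2 : ℝ) ^ R)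
    (hw : ∀ args, Gate.sum args ∈ gs → ∀ a ∈ args, ‖a.1‖ ≤ (2 : ℝ) ^ R)
    (hval : ∀ v ∈ gateValues gs, ‖eval (boolPoint ℂ x) v‖ ≤ (2 : ℝ) ^ R)
    (hsmall : ((gs.length : ℝ) + 1) * ((2 : ℝ) ^ (R + 2) + 8) ^ (gs.length + 1) / (2 : ℝ) ^ B ≤ 1) :
    ∀ (i : ℕ) (hi : i < (gateValuesFx (R + 2) B x gs).length),
      ‖((gateValuesFx (R + 2) B x gs)[i] : ℂ) / (2 : ℂ) ^ B -
          eval (boolPoint ℂ x) ((gateValues gs)[i]'(by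
            rw [gateValues_length, ← length_gateValuesFx (R + 2) B x gs]; exact hi))‖ ≤
        ((i : ℝ) + 1) * ((2 : ℝ) ^ (R + 2) + 8) ^ (i + 1) / (2 : ℝ) ^ B := by
  set K : ℝ := (2 : ℝ) ^ (R + 2) + 8 with hKdef
  have hK1 : 1 ≤ K := by
    have : (0 : ℝ) ≤ (2 : ℝ) ^ (R + 2) := by positivity
    rw [hKdef]; linarith
  have hB : (0 : ℝ) < (2 : ℝ) ^ B := by positivity
  induction gs using List.reverseRecOn with
  | nil => intro i hi; simp [gateValuesFx] at hi
  | append_singleton gs g ih =>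
    intro i hi
    have hlenfx : (gateValuesFx (R + 2) B x gs).length = gs.length := length_gateValuesFx _ _ _ _
    have hlenv : (gateValues gs).length = gs.length := gateValues_length gs
    -- the induction hypothesis on the prefix
    have hsmall' : ((gs.length : ℝ) + 1) * K ^ (gs.length + 1) / (2 : ℝ) ^ B ≤ 1 := by
      refine le_trans ?_ hsmall
      rw [List.length_append, List.length_singleton]
      refine div_le_div_of_nonneg_right ?_ hB.le
      push_cast
      have := budget_mono hK1 (i := gs.length) (n := gs.length + 1 + 1) (by omega)
      push_cast at this
      exact this
    have ih' := ih (fun g' hg' => hfan g' (by simp [hg']))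
      (fun g' hg' => hconst g' (by simp [hg']))
      (fun args hargs => hw args (by simp [hargs]))
      (fun v hv => hval v (by rw [gateValues_append_singleton]; exact List.mem_append_left _ hv))
      hsmall'
    simp only [gateValuesFx_append_singleton, gateValues_append_singleton]
    rw [gateValuesFx_append_singleton, List.length_append, List.length_singleton] at hi
    by_cases hlt : i < (gateValuesFx (R + 2) B x gs).length
    · -- an old gate
      rw [List.getElem_append_left hlt,
        List.getElem_append_left (by rw [hlenv, ← hlenfx]; exact hlt)]
      exact ih' i hlt
    · -- the new gate
      have hieq : i = (gateValuesFx (R + 2) B x gs).length := by omega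
      subst hieq
      rw [List.getElem_append_right (le_refl _), List.getElem_append_right (by rw [hlenv, ← hlenfx])]
      simp only [Nat.sub_self, List.getElem_cons_zero, hlenfx, hlenv]
      -- error budget of the operands: `η = n K^n / 2^B`
      set n := gs.length with hn
      set η : ℝ := (n : ℝ) * K ^ n / (2 : ℝ) ^ B with hηdef
      have hη : 0 ≤ η := by positivity
      have herr : ∀ (j : ℕ) (hj : j < (gateValuesFx (R + 2) B x gs).length),
          ‖((gateValuesFx (R + 2) B x gs)[j] : ℂ) / (2 : ℂ) ^ B -
            eval (boolPoint ℂ x) ((gateValues gs)[j]'(hlenv ▸ hlenfx ▸ hj))‖ ≤ η := by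
        intro j hj
        refine (ih' j hj).trans ?_
        rw [hηdef]
        exact div_le_div_of_nonneg_right (budget_mono hK1 (by rw [hlenfx] at hj; omega)) hB.le
      have hKη : K * (η + 1 / (2 : ℝ) ^ B) ≤ 1 := by
        refine le_trans ?_ hsmall'
        rw [hηdef, show K * ((n : ℝ) * K ^ n / (2 : ℝ) ^ B + 1 / (2 : ℝ) ^ B) =
          ((n : ℝ) * K ^ (n + 1) + K) / (2 : ℝ) ^ B by rw [pow_succ]; ring]
        refine div_le_div_of_nonneg_right ?_ hB.le
        have : K ≤ K ^ (n + 1) := by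
          calc K = K ^ 1 := (pow_one K).symm
            _ ≤ K ^ (n + 1) := pow_le_pow_right₀ hK1 (by omega)
        nlinarith
      have hgmem : g ∈ gs ++ [g] := by simp
      have hgval : ‖eval (boolPoint ℂ x) (g.eval (gateValues gs))‖ ≤ (2 : ℝ) ^ R :=
        hval _ (by rw [gateValues_append_singleton]; simp)
      have hstep := gateFx_error x R B (gateValues gs) (gateValuesFx (R + 2) B x gs) η
        (hlenfx.trans hlenv.symm) hη hKη herr
        (fun v hv => hval v (by rw [gateValues_append_singleton]; exact List.mem_append_left _ hv))
        g (hfan g hgmem) (fun u hu a ha => hconst g hgmem u hu a ha)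
        (fun args hargs a ha => hw args (by rw [← hargs]; exact hgmem) a ha) hgval
      refine hstep.trans ?_
      rw [hηdef, show K * ((n : ℝ) * K ^ n / (2 : ℝ) ^ B + 1 / (2 : ℝ) ^ B) =
        ((n : ℝ) * K ^ (n + 1) + K) / (2 : ℝ) ^ B by rw [pow_succ]; ring]
      refine div_le_div_of_nonneg_right ?_ hB.le
      have : K ≤ K ^ (n + 1) := by
        calc K = K ^ 1 := (pow_one K).symm
          _ ≤ K ^ (n + 1) := pow_le_pow_right₀ hK1 (by omega)
      nlinarith

end Run

/-! ### The precision bookkeeping -/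

/-- `4 (s+1) (2^{R+2}+8)^{s+1} ≤ 2^B` whenever `(R+s+2)^3 ≤ B`. [folklore] -/
theorem budget_le_two_pow {R s B : ℕ} (hB : (R + s + 2) ^ 3 ≤ B) :
    4 * (s + 1) * (2 ^ (R + 2) + 8) ^ (s + 1) ≤ 2 ^ B := by
  have hK : 2 ^ (R + 2) + 8 ≤ 2 ^ (R + 4) := by
    have : 4 ≤ 2 ^ (R + 2) := by
      calc 4 = 2 ^ 2 := by norm_num
        _ ≤ 2 ^ (R + 2) := Nat.pow_le_pow_right (by norm_num) (by omega)
    have h4 : 2 ^ (R + 4) = 4 * 2 ^ (R + 2) := by rw [pow_add]; ring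
    omega
  have hs : s + 1 ≤ 2 ^ s := Nat.lt_two_pow_self
  have he : 2 + s + (R + 4) * (s + 1) ≤ B := by
    refine le_trans ?_ hB
    have h1 : 2 * (R + s + 2) ^ 2 ≤ (R + s + 2) ^ 3 := by
      have h22 : 2 ≤ R + s + 2 := by omega
      calc 2 * (R + s + 2) ^ 2 ≤ (R + s + 2) * (R + s + 2) ^ 2 := Nat.mul_le_mul_right _ h22
        _ = (R + s + 2) ^ 3 := by ring
    refine le_trans ?_ h1
    nlinarith [Nat.zero_le (R * s), Nat.zero_le R, Nat.zero_le s]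
  calc 4 * (s + 1) * (2 ^ (R + 2) + 8) ^ (s + 1)
      ≤ 4 * 2 ^ s * (2 ^ (R + 4)) ^ (s + 1) :=
        Nat.mul_le_mul (Nat.mul_le_mul_left 4 hs) (Nat.pow_le_pow_left hK _)
    _ = 2 ^ (2 + s + (R + 4) * (s + 1)) := by
        rw [← pow_mul, show (4 : ℕ) = 2 ^ 2 by norm_num, ← pow_add, ← pow_add]
    _ ≤ 2 ^ B := Nat.pow_le_pow_right (by norm_num) he

/-- **`stub_rounding` (ERROR RECURSION for the clamped complex fixed-point run; registered stub 1 of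
the crux line `Cruxes/TameA3/Lines/birth.lean`, stmt-ValiantsHypothesis-5386), with `c = 3`.** For
every fan-in-two circuit `P` over `ℂ`, every Boolean point `x` and every `R` bounding the moduli of
the constants, sum weights, output constant and of ALL exact gate values at `x` by `2^R`, and every
precision `B ≥ (R + |P| + 2)^3`, the clamped fixed-point run in format `(R+2, B)` is within `1/2` of
the exact output: `‖evalFx P (R+2) B x / 2^B − eval (boolPoint x) P.eval‖ < 1/2`. (Forward error
analysis: gate `i` is tracked to within `(i+1)K^{i+1}/2^B`, `K = 2^{R+2}+8 ≤ 2^{R+4}`, every clamp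
is idle, and `4(|P|+1)K^{|P|+1} ≤ 2^B`.) [cite: Burgisser2000TCS, §5 (A3)] -/
theorem stub_rounding :
    ∃ c : ℕ, ∀ (n R B : ℕ) (P : ArithCircuit ℂ (Fin n)) (x : Fin n → Bool),
      P.IsFanInTwo →
      (∀ g ∈ P.gates, ∀ u ∈ ArithCircuit.Gate.args g, ∀ a : ℂ,
        u = ArithCircuit.Operand.const a → ‖a‖ ≤ (2 : ℝ) ^ R) →
      (∀ args, ArithCircuit.Gate.sum args ∈ P.gates → ∀ a ∈ args, ‖a.1‖ ≤ (2 : ℝ) ^ R) →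
      (∀ a : ℂ, P.output = ArithCircuit.Operand.const a → ‖a‖ ≤ (2 : ℝ) ^ R) →
      (∀ g ∈ ArithCircuit.gateValues P.gates, ‖MvPolynomial.eval (boolPoint ℂ x) g‖ ≤ (2 : ℝ) ^ R) →
      (R + P.size + 2) ^ c ≤ B →
      ‖GaussianInt.toComplex (FixedPoint.evalFx P (R + 2) B x) / (2 : ℂ) ^ B
          - MvPolynomial.eval (boolPoint ℂ x) P.eval‖ < 1 / 2 := by
  refine ⟨3, fun n R B P x h2 hconst hw hout hval hB => ?_⟩
  set K : ℝ := (2 : ℝ) ^ (R + 2) + 8 with hKdef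
  set s := P.size with hs
  have hB0 : (0 : ℝ) < (2 : ℝ) ^ B := by positivity
  have hK1 : 1 ≤ K := by
    have : (0 : ℝ) ≤ (2 : ℝ) ^ (R + 2) := by positivity
    rw [hKdef]; linarith
  -- the precision budget: `(s+1) K^{s+1} / 2^B ≤ 1/4`
  have hbudget : ((s : ℝ) + 1) * K ^ (s + 1) / (2 : ℝ) ^ B ≤ 1 / 4 := by
    have hnat := budget_le_two_pow hB
    have hreal : (4 : ℝ) * ((s : ℝ) + 1) * K ^ (s + 1) ≤ (2 : ℝ) ^ B := by
      rw [hKdef]; exact_mod_cast hnat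
    rw [div_le_iff₀ hB0]
    linarith
  have hsmall : ((P.gates.length : ℝ) + 1) * K ^ (P.gates.length + 1) / (2 : ℝ) ^ B ≤ 1 := by
    rw [show P.gates.length = s from rfl]; linarith
  -- the run, gate by gate
  have hrun := gateValuesFx_error x R B P.gates h2 hconst hw hval hsmall
  have hlenfx : (gateValuesFx (R + 2) B x P.gates).length = s := length_gateValuesFx _ _ _ _
  have hlenv : (gateValues P.gates).length = s := gateValues_length _
  -- all stored gate values are within `η = s K^s / 2^B`
  set η : ℝ := (s : ℝ) * K ^ s / (2 : ℝ) ^ B with hηdef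
  have hη : 0 ≤ η := by positivity
  have herr : ∀ (j : ℕ) (hj : j < (gateValuesFx (R + 2) B x P.gates).length),
      ‖((gateValuesFx (R + 2) B x P.gates)[j] : ℂ) / (2 : ℂ) ^ B -
        eval (boolPoint ℂ x) ((gateValues P.gates)[j]'(hlenv ▸ hlenfx ▸ hj))‖ ≤ η := by
    intro j hj
    refine (hrun j hj).trans ?_
    rw [hηdef]
    exact div_le_div_of_nonneg_right (budget_mono hK1 (by rw [hlenfx] at hj; omega)) hB0.le
  -- the output operand
  obtain ⟨hfinal, -⟩ := operandFx_error x R B (gateValues P.gates) (gateValuesFx (R + 2) B x P.gates)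
    η (hlenfx.trans hlenv.symm) hη herr hval P.output hout
  change ‖((operandFx (R + 2) B x (gateValuesFx (R + 2) B x P.gates) P.output : GaussianInt) : ℂ) /
      (2 : ℂ) ^ B - eval (boolPoint ℂ x) (P.output.eval (gateValues P.gates))‖ < 1 / 2
  refine lt_of_le_of_lt hfinal ?_
  -- `η + 2^{-B} ≤ (s+1) K^{s+1} / 2^B ≤ 1/4 < 1/2`
  have hle : η + 1 / (2 : ℝ) ^ B ≤ ((s : ℝ) + 1) * K ^ (s + 1) / (2 : ℝ) ^ B := by
    rw [hηdef, ← add_div]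
    refine div_le_div_of_nonneg_right ?_ hB0.le
    have h1 : K ^ s ≤ K ^ (s + 1) := pow_le_pow_right₀ hK1 (by omega)
    have h2 : (1 : ℝ) ≤ K ^ (s + 1) := one_le_pow₀ hK1
    have h3 : (0 : ℝ) ≤ (s : ℝ) := by positivity
    nlinarith
  linarith

end Summit.ValiantsHypothesis.ValiantsHypothesis.Theorems.NumTame

end
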